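import Summits.QuantumFields.YangMills.Theorems.BalabanUVNodesPortU8ImagesNearClauses
import Summits.QuantumFields.YangMills.Theorems.BalabanUVNodesPortU8TwoVolumeRowLocUniv

/-!
# Port piece U8 — THE METHOD OF IMAGES, FILE 4c: ★★★ THE TWO-VOLUME ROW (R4ᴰ)′ FOR THE WHOLE-TORUS LOCALIZED RESPONSE WITHOUT (Tok-cmpU-cap):
# `sandwich_clauses_images` (per bond: NEAR″ = file 4b's images clauses, FAR = ‴ on both members) and ★★★ `rowR4D_LocUniv_images` (the gauge row)

Cell `ym-nodeO-ideate` ∕ `ym-balaban-port`, porter `ymgap-nodeO-port-PTB-1` (gen 5).  JOIN-side helper for **stmt-QuantumFields-27238** (K0ᴬ), `--supports … --as helper`.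
[I] = [Balaban1987RG1], [15] = [Balaban1985Variational], [B5] = [Balaban1984PropagatorsI], [B6] = [Balaban1984PropagatorsII].

WHAT IS PROVED (kernel, sorry-free).  ✓`sandwich_clauses_LocUniv` ∕ ✓`rowR4D_LocUniv_sandwich` (g4 file 2) had two displayed inputs: the ‴-clauses (now PROVED, g4∕g5 clause files) and
(Tok-cmpU-cap) — the window-vs-whole-torus comparison of `recordHrLocξ`, used ONLY on the NEAR bonds.  Here the NEAR bonds are served instead by file 4b's ★★★`images_near_clauses`
(the method of images: both volumes' responses are periodisations of ONE infinite-lattice kernel, their difference near the label is two lattice tails), so (Tok-cmpU-cap) DISAPPEARS: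
§1 ★★ `sandwich_clauses_images` — the four (190)-clause expressions of `E := HrLocξ_{K+1}(univ) ∘ lift − HrLocξ_K(univ)` on every bond of an off-wrap domain are
   `≤ Ĉ·η^j·e^{−r·tdist(coarse β₋, y₂)}`, `r = min(δ₉∕8, δ_I)`, `Ĉ = (2C·e^{δ₉(2Mc+2)} + A)·e^{−r·ρ}` — inputs: the ‴-clauses at both members (displayed here, PROVED upstream) and the
   images clauses of file 4b in hypothesis form (`hI`, inhabited by ✓`images_near_clauses`).
§2 ★★★ `rowR4D_LocUniv_images` — the GLOBAL two-volume row in (4.4)-gauge currency for the whole-torus localized data `recordGkLocWξ … Finset.univ`, from §1 exactly as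
   ✓`rowR4D_capped_sandwich` is from ✓`sandwich_clauses_capped`: `gauge ≤ C₄·e^{−(2r)·ρ∕2}·e^{−((2r)∕2)·dist(y, X)}`.

HONEST FRAMING.  Bookkeeping over PROVED tree theorems plus the displayed ‴-clauses; nothing of Bałaban asserted; 27931 CLOSED·IMPLICATION-ONLY·IN TOTO unchanged; K0ᴬ 27238 OPEN;
NODE O 0∕1; COUNT 8∕28 · K 1∕4 UNMOVED; finite `𝕋⁴_{L^K}` at fixed ε — NOT continuum ∕ OS ∕ Clay; **the Yang–Mills mass gap (Clay) is NOT proved.**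
-/

noncomputable section

open scoped BigOperators Matrix.Norms.L2Operator
open Complex (I)

namespace Summit.QuantumFields.YangMills.Theorems.PortU8

open Literature.MathematicalPhysics.QuantumFieldTheory.Balaban1983to89
open Literature.MathematicalPhysics.QuantumFieldTheory.Balaban1983to89.Node00
open Literature.MathematicalPhysics.QuantumFieldTheory.Balaban1983to89.T4Continuum (T4Family)
open Literature.MathematicalPhysics.QuantumFieldTheory.Balaban1983to89.B14.Eq213MaximalDomains (side)
open Summit.QuantumFields.YangMills.Theorems.K0RecordFormatNames

variable (F : T4Family)

section Images

variable {F}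
variable (a₀ ε₂₉ : ℝ) {Mc k K : ℕ}

/-! ## §1  ★★ The per-bond clauses: NEAR″ by images, FAR by ‴ -/
set_option maxHeartbeats 400000 in
/-- ★★ **THE SANDWICH WITHOUT A CAP**: for the whole-torus localized responses `HrLocξ_K(univ)(y)`, `HrLocξ_{K+1}(univ)(y′)` (labels `recordE K μ z`, `recordE (K+1) μ z`) obeying the
‴-clauses (`h3`, `h3′`) and the images clauses of file 4b (`hI`): on every bond `β` of an off-wrap domain `X` the four clause expressions of `E := HrLocξ_{K+1} ∘ lift − HrLocξ_K`
are `≤ Ĉ·η^j·e^{−r·tdist(coarse β₋, y₂)}`, `r = min(δ₉∕8, δ_I)`, `Ĉ = (2C·e^{δ₉(2Mc+2)} + A)·e^{−r·ρ}`.  NEAR (`coarse β₋` in the window of radius `ρ∕4 − 2Mc`): `hI` with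
`N_K = 2ρ ≥ ρ + tdist`; FAR: ‴ on both members (✓`exp_far_le`, ✓`tdist_le_tdist_liftSiteCtr`). [cite: Balaban1987RG1, (1.21) p.264, p.290 L17–20, (4.35) p.290; Balaban1985Variational, (190) p.308; Balaban1984PropagatorsI, p.36 ll.20–23] -/
theorem sandwich_clauses_images (hMc : McGuard F Mc) (hK : recordK₀ F Mc k ≤ K) (a : (thetaFill F a₀ ε₂₉).ιβ) (μ : Fin 4) (z : Fin 4 → ℤ)
    (hz : ∀ l, 2 * |z l| < (recordRNat F Mc k K : ℤ)) {X : (recordDomSys F Mc k K).Dom} (hX : X ∉ recordWrapCtr F Mc k K)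
    {C δ₉ : ℝ} (hC : 0 ≤ C) (hδ : 0 < δ₉)
    (h3 : letI Hr := recordHrLocξ F (thetaFill F a₀ ε₂₉) k K Finset.univ a (recordE F k K μ z);
      ∀ b : PBond (F.P K) 0,
        ‖Hr b‖ ≤ C * (F.P K).eta (k + 1) * Real.exp (-(δ₉ * (Site.tdist (coarsenTo (k + 1) b.src) (recordE F k K μ z).2 : ℝ))) ∧
        (∀ ν : Fin (F.P K).d, ‖Hr ⟨b.src.shift ν, b.dir⟩ - Hr b‖ ≤ C * (F.P K).eta (k + 1) ^ 2 * Real.exp (-(δ₉ * (Site.tdist (coarsenTo (k + 1) b.src) (recordE F k K μ z).2 : ℝ)))) ∧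
        ‖∑ ν : Fin (F.P K).d, (Hr ⟨b.src.shift ν, b.dir⟩ - (2 : ℂ) • Hr b + Hr ⟨b.src.unshift ν, b.dir⟩)‖ ≤
          C * (F.P K).eta (k + 1) ^ 3 * Real.exp (-(δ₉ * (Site.tdist (coarsenTo (k + 1) b.src) (recordE F k K μ z).2 : ℝ))) ∧
        ‖∑ ν : Fin (F.P K).d, ((Hr ⟨b.src, b.dir⟩ + Hr ⟨(b.src).shift b.dir, ν⟩ - Hr ⟨(b.src).shift ν, b.dir⟩ - Hr ⟨b.src, ν⟩) -
          (Hr ⟨b.src.unshift ν, b.dir⟩ + Hr ⟨(b.src.unshift ν).shift b.dir, ν⟩ - Hr ⟨(b.src.unshift ν).shift ν, b.dir⟩ - Hr ⟨b.src.unshift ν, ν⟩))‖ ≤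
          C * (F.P K).eta (k + 1) ^ 3 * Real.exp (-(δ₉ * (Site.tdist (coarsenTo (k + 1) b.src) (recordE F k K μ z).2 : ℝ))))
    (h3' : letI Hr := recordHrLocξ F (thetaFill F a₀ ε₂₉) k (K + 1) Finset.univ a (recordE F k (K + 1) μ z);
      ∀ b : PBond (F.P (K + 1)) 0,
        ‖Hr b‖ ≤ C * (F.P (K + 1)).eta (k + 1) * Real.exp (-(δ₉ * (Site.tdist (coarsenTo (k + 1) b.src) (recordE F k (K + 1) μ z).2 : ℝ))) ∧
        (∀ ν : Fin (F.P (K + 1)).d, ‖Hr ⟨b.src.shift ν, b.dir⟩ - Hr b‖ ≤ C * (F.P (K + 1)).eta (k + 1) ^ 2 * Real.exp (-(δ₉ * (Site.tdist (coarsenTo (k + 1) b.src) (recordE F k (K + 1) μ z).2 : ℝ)))) ∧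
        ‖∑ ν : Fin (F.P (K + 1)).d, (Hr ⟨b.src.shift ν, b.dir⟩ - (2 : ℂ) • Hr b + Hr ⟨b.src.unshift ν, b.dir⟩)‖ ≤
          C * (F.P (K + 1)).eta (k + 1) ^ 3 * Real.exp (-(δ₉ * (Site.tdist (coarsenTo (k + 1) b.src) (recordE F k (K + 1) μ z).2 : ℝ))) ∧
        ‖∑ ν : Fin (F.P (K + 1)).d, ((Hr ⟨b.src, b.dir⟩ + Hr ⟨(b.src).shift b.dir, ν⟩ - Hr ⟨(b.src).shift ν, b.dir⟩ - Hr ⟨b.src, ν⟩) -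
          (Hr ⟨b.src.unshift ν, b.dir⟩ + Hr ⟨(b.src.unshift ν).shift b.dir, ν⟩ - Hr ⟨(b.src.unshift ν).shift ν, b.dir⟩ - Hr ⟨b.src.unshift ν, ν⟩))‖ ≤
          C * (F.P (K + 1)).eta (k + 1) ^ 3 * Real.exp (-(δ₉ * (Site.tdist (coarsenTo (k + 1) b.src) (recordE F k (K + 1) μ z).2 : ℝ))))
    {δI A : ℝ} (hδI : 0 ≤ δI) (hA : 0 ≤ A)
    (hI : ∀ R : ℕ, (∀ i, 2 * (|(-z) i| + R) < ((F.P K).sitesPerDir (k + 1) : ℤ)) →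
      ∀ {X : (recordDomSys F Mc k K).Dom}, X ∉ recordWrapCtr F Mc k K → ∀ {β : PBond (F.P K) 0}, β ∈ domBonds F Mc k K X →
      coarsenTo (k + 1) β.src ∈ recordWindow F k K R (-z) →
      letI E : PBond (F.P K) 0 → Fin 2 → Fin 2 → ℂ := fun b' =>
        recordHrLocξ F (thetaFill F a₀ ε₂₉) k (K + 1) Finset.univ a (recordE F k (K + 1) μ z) (liftBondCtr F K 0 b') - recordHrLocξ F (thetaFill F a₀ ε₂₉) k K Finset.univ a (recordE F k K μ z) b'
      letI B : ℝ := A * Real.exp (-(δI * ((F.P K).sitesPerDir (k + 1) : ℝ)))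
      ‖E ⟨β.src, β.dir⟩‖ ≤ B * (F.P K).eta (k + 1) ∧
      (∀ ν : Fin (F.P K).d, ‖E ⟨β.src.shift ν, β.dir⟩ - E ⟨β.src, β.dir⟩‖ ≤ B * (F.P K).eta (k + 1) ^ 2) ∧
      ‖∑ ν : Fin (F.P K).d, (E ⟨β.src.shift ν, β.dir⟩ - (2 : ℂ) • E ⟨β.src, β.dir⟩ + E ⟨β.src.unshift ν, β.dir⟩)‖ ≤ B * (F.P K).eta (k + 1) ^ 3 ∧
      ‖∑ ν : Fin (F.P K).d, ((E ⟨β.src, β.dir⟩ + E ⟨β.src.shift β.dir, ν⟩ - E ⟨β.src.shift ν, β.dir⟩ - E ⟨β.src, ν⟩) -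
        (E ⟨β.src.unshift ν, β.dir⟩ + E ⟨(β.src.unshift ν).shift β.dir, ν⟩ - E ⟨(β.src.unshift ν).shift ν, β.dir⟩ - E ⟨β.src.unshift ν, ν⟩))‖ ≤
        B * (F.P K).eta (k + 1) ^ 3)
    {β : PBond (F.P K) 0} (hβ : β ∈ domBonds F Mc k K X) :
    letI E : PBond (F.P K) 0 → Fin 2 → Fin 2 → ℂ := fun b' => recordHrLocξ F (thetaFill F a₀ ε₂₉) k (K + 1) Finset.univ a (recordE F k (K + 1) μ z) (liftBondCtr F K 0 b') -
      recordHrLocξ F (thetaFill F a₀ ε₂₉) k K Finset.univ a (recordE F k K μ z) b'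
    letI Ch : ℝ := (2 * C * Real.exp (δ₉ * (2 * Mc + 2)) + A) * Real.exp (-(min (δ₉ / 8) δI) * recordRNat F Mc k K)
    letI e : ℝ := Real.exp (-(min (δ₉ / 8) δI * (Site.tdist (coarsenTo (k + 1) β.src) (recordE F k K μ z).2 : ℝ)))
    ‖E ⟨β.src, β.dir⟩‖ ≤ Ch * (F.P K).eta (k + 1) * e ∧
    (∀ ν : Fin (F.P K).d, ‖E ⟨β.src.shift ν, β.dir⟩ - E ⟨β.src, β.dir⟩‖ ≤ Ch * (F.P K).eta (k + 1) ^ 2 * e) ∧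
    ‖∑ ν : Fin (F.P K).d, (E ⟨β.src.shift ν, β.dir⟩ - (2 : ℂ) • E ⟨β.src, β.dir⟩ + E ⟨β.src.unshift ν, β.dir⟩)‖ ≤ Ch * (F.P K).eta (k + 1) ^ 3 * e ∧
    ‖∑ ν : Fin (F.P K).d, ((E ⟨β.src, β.dir⟩ + E ⟨β.src.shift β.dir, ν⟩ - E ⟨β.src.shift ν, β.dir⟩ - E ⟨β.src, ν⟩) -
      (E ⟨β.src.unshift ν, β.dir⟩ + E ⟨(β.src.unshift ν).shift β.dir, ν⟩ - E ⟨(β.src.unshift ν).shift ν, β.dir⟩ - E ⟨β.src.unshift ν, ν⟩))‖ ≤ Ch * (F.P K).eta (k + 1) ^ 3 * e := by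
  have hk : k + 1 ≤ F.m + K := by unfold recordK₀ at hK; omega
  obtain ⟨hsh, hun, hus⟩ := stencil_commute_of_mem_domBonds hMc hK hX hβ
  obtain ⟨_, _, _, _, hR3lo, h4R3⟩ := sandwich_radii hMc hK
  have hnw : NoWrapAt F k K (recordRNat F Mc k K / 2 - 1) (-z) := noWrapAt_sandwich hMc hK hz
  have hl2 : (recordE F k (K + 1) μ z).2 = liftSiteCtr F K (k + 1) (recordE F k K μ z).2 := recordE_succ_snd_eq_lift F hMc hK μ z hz
  have hy2 : (recordE F k K μ z).2 = siteOfInt F K (k + 1) (-z) := rfl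
  have heta : (F.P (K + 1)).eta (k + 1) = (F.P K).eta (k + 1) := rfl
  have hη0 : 0 < (F.P K).eta (k + 1) := by unfold Params.eta; exact pow_pos (inv_pos.2 (F.P K).cast_L_pos) _
  have hη2 := pow_pos hη0 2
  have hη3 := pow_pos hη0 3
  have hMc0 : (0 : ℝ) ≤ Mc := Nat.cast_nonneg _
  have hρ0 : (0 : ℝ) ≤ (recordRNat F Mc k K : ℝ) := Nat.cast_nonneg _
  have ht0 : (0 : ℝ) ≤ (Site.tdist (coarsenTo (k + 1) β.src) (recordE F k K μ z).2 : ℝ) := Nat.cast_nonneg _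
  -- the final rate `r = min (δ₉/8) δI` and constant
  have hr8 : min (δ₉ / 8) δI ≤ δ₉ / 8 := min_le_left _ _
  have hrI : min (δ₉ / 8) δI ≤ δI := min_le_right _ _
  have hr0 : 0 ≤ min (δ₉ / 8) δI := le_min (by positivity) hδI
  have hCA : 2 * C * Real.exp (δ₉ * (2 * Mc + 2)) ≤ 2 * C * Real.exp (δ₉ * (2 * Mc + 2)) + A := by linarith
  have hCA0 : 0 ≤ 2 * C * Real.exp (δ₉ * (2 * Mc + 2)) + A := by positivity
  -- coarse site of the lifted bond = lift of the coarse site; torus distances do not decrease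
  have hcoarse : coarsenTo (k + 1) (liftBondCtr F K 0 β).src = liftSiteCtr F K (k + 1) (coarsenTo (k + 1) β.src) :=
    coarsenTo_liftSiteCtr_of_mem_domSites hMc hK hX hβ.1
  have htt : (Site.tdist (coarsenTo (k + 1) β.src) (recordE F k K μ z).2 : ℝ) ≤ (Site.tdist (coarsenTo (k + 1) (liftBondCtr F K 0 β).src) (recordE F k (K + 1) μ z).2 : ℝ) := by
    rw [hcoarse, hl2]; exact_mod_cast tdist_le_tdist_liftSiteCtr F K (k + 1) hk _ _
  by_cases hnear : coarsenTo (k + 1) β.src ∈ recordWindow F k K (recordRNat F Mc k K / 4 - 2 * Mc) (-z)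
  · -- NEAR″: the images clauses; `N_K = 2ρ ≥ ρ + tdist`
    have hcR3 : ∀ i, 2 * (|(-z) i| + ((recordRNat F Mc k K / 4 - 2 * Mc) : ℕ)) < ((F.P K).sitesPerDir (k + 1) : ℤ) := fun i => by
      have := NoWrapAt.two_mul_lt F hnw (Nat.le_succ (recordRNat F Mc k K / 2 - 1)) i
      linarith
    have hB := hI (recordRNat F Mc k K / 4 - 2 * Mc) hcR3 hX hβ hnear
    have ht4 : (Site.tdist (coarsenTo (k + 1) β.src) (recordE F k K μ z).2 : ℝ) ≤ (recordRNat F Mc k K : ℝ) := by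
      have h1 := tdist_le_of_mem_window F (z₀ := -z) hnear
      rw [← hy2] at h1
      have h1c : (Site.tdist (coarsenTo (k + 1) β.src) (recordE F k K μ z).2 : ℝ) ≤ ((4 * (recordRNat F Mc k K / 4 - 2 * Mc) : ℕ) : ℝ) := by exact_mod_cast h1
      have h2 : ((4 * (recordRNat F Mc k K / 4 - 2 * Mc) : ℕ) : ℝ) ≤ (recordRNat F Mc k K : ℝ) := by exact_mod_cast h4R3
      linarith
    have hN : ((F.P K).sitesPerDir (k + 1) : ℝ) = 2 * (recordRNat F Mc k K : ℝ) := by exact_mod_cast sitesPerDir_eq_two_mul_recordRNat hMc hK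
    have hexp : A * Real.exp (-(δI * ((F.P K).sitesPerDir (k + 1) : ℝ))) ≤
        (2 * C * Real.exp (δ₉ * (2 * Mc + 2)) + A) * Real.exp (-(min (δ₉ / 8) δI) * recordRNat F Mc k K) *
          Real.exp (-(min (δ₉ / 8) δI * (Site.tdist (coarsenTo (k + 1) β.src) (recordE F k K μ z).2 : ℝ))) := by
      rw [hN, mul_assoc, ← Real.exp_add]
      have h1 : Real.exp (-(δI * (2 * (recordRNat F Mc k K : ℝ)))) ≤
          Real.exp (-(min (δ₉ / 8) δI) * recordRNat F Mc k K + -(min (δ₉ / 8) δI * (Site.tdist (coarsenTo (k + 1) β.src) (recordE F k K μ z).2 : ℝ))) :=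
        Real.exp_le_exp.2 (by nlinarith [mul_le_mul_of_nonneg_right hrI hρ0, mul_le_mul_of_nonneg_left ht4 hr0])
      have hA' : A ≤ 2 * C * Real.exp (δ₉ * (2 * Mc + 2)) + A := by nlinarith [Real.exp_pos (δ₉ * (2 * Mc + 2))]
      exact mul_le_mul hA' h1 (Real.exp_pos _).le hCA0
    obtain ⟨k1, k2, k3, k4⟩ := hB
    refine ⟨k1.trans ?_, fun ν => (k2 ν).trans ?_, k3.trans ?_, k4.trans ?_⟩
    · have := mul_le_mul_of_nonneg_right hexp hη0.le; linarith
    · have := mul_le_mul_of_nonneg_right hexp hη2.le; linarith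
    · have := mul_le_mul_of_nonneg_right hexp hη3.le; linarith
    · have := mul_le_mul_of_nonneg_right hexp hη3.le; linarith
  · -- FAR: ‴ on both members; the lifted bond is at least as far from the lifted label
    have hA := h3' (liftBondCtr F K 0 β)
    have hB := h3 β
    rw [heta] at hA
    have htR : (recordRNat F Mc k K : ℝ) / 4 - 2 * Mc - 1 ≤ (Site.tdist (coarsenTo (k + 1) β.src) (recordE F k K μ z).2 : ℝ) := by
      have h1 := succ_le_tdist_of_not_mem_window F (z₀ := -z) hnear
      rw [← hy2] at h1
      have h1c : ((((recordRNat F Mc k K / 4 - 2 * Mc) + 1 : ℕ)) : ℝ) ≤ (Site.tdist (coarsenTo (k + 1) β.src) (recordE F k K μ z).2 : ℝ) := by exact_mod_cast h1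
      push_cast at h1c
      linarith
    have hexpB := exp_far_le (δ := δ₉) hδ.le hMc0 hρ0 htR
    have hexpA : Real.exp (-(δ₉ * (Site.tdist (coarsenTo (k + 1) (liftBondCtr F K 0 β).src) (recordE F k (K + 1) μ z).2 : ℝ))) ≤
        Real.exp (δ₉ * (2 * Mc + 2)) * Real.exp (-(δ₉ / 8) * (recordRNat F Mc k K : ℝ)) * Real.exp (-(δ₉ / 8 * (Site.tdist (coarsenTo (k + 1) β.src) (recordE F k K μ z).2 : ℝ))) := by
      refine le_trans (Real.exp_le_exp.2 ?_) hexpB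
      have := mul_le_mul_of_nonneg_left htt hδ.le
      linarith
    -- weaken the rate `δ₉/8 ↦ r` and the constant `2C·e^{…} ↦ 2C·e^{…} + A`
    have hw1 : Real.exp (-(δ₉ / 8) * (recordRNat F Mc k K : ℝ)) ≤ Real.exp (-(min (δ₉ / 8) δI) * recordRNat F Mc k K) :=
      Real.exp_le_exp.2 (by nlinarith [mul_le_mul_of_nonneg_right hr8 hρ0])
    have hw2 : Real.exp (-(δ₉ / 8 * (Site.tdist (coarsenTo (k + 1) β.src) (recordE F k K μ z).2 : ℝ))) ≤
        Real.exp (-(min (δ₉ / 8) δI * (Site.tdist (coarsenTo (k + 1) β.src) (recordE F k K μ z).2 : ℝ))) :=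
      Real.exp_le_exp.2 (by nlinarith [mul_le_mul_of_nonneg_right hr8 ht0])
    have hW : Real.exp (δ₉ * (2 * Mc + 2)) * Real.exp (-(δ₉ / 8) * (recordRNat F Mc k K : ℝ)) * Real.exp (-(δ₉ / 8 * (Site.tdist (coarsenTo (k + 1) β.src) (recordE F k K μ z).2 : ℝ))) ≤
        Real.exp (δ₉ * (2 * Mc + 2)) * Real.exp (-(min (δ₉ / 8) δI) * recordRNat F Mc k K) *
          Real.exp (-(min (δ₉ / 8) δI * (Site.tdist (coarsenTo (k + 1) β.src) (recordE F k K μ z).2 : ℝ))) :=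
      mul_le_mul (mul_le_mul_of_nonneg_left hw1 (Real.exp_pos _).le) hw2 (Real.exp_pos _).le (by positivity)
    have hsum : C * Real.exp (-(δ₉ * (Site.tdist (coarsenTo (k + 1) (liftBondCtr F K 0 β).src) (recordE F k (K + 1) μ z).2 : ℝ))) +
        C * Real.exp (-(δ₉ * (Site.tdist (coarsenTo (k + 1) β.src) (recordE F k K μ z).2 : ℝ))) ≤
        (2 * C * Real.exp (δ₉ * (2 * Mc + 2)) + A) * Real.exp (-(min (δ₉ / 8) δI) * recordRNat F Mc k K) *
          Real.exp (-(min (δ₉ / 8) δI * (Site.tdist (coarsenTo (k + 1) β.src) (recordE F k K μ z).2 : ℝ))) := by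
      have h1 := mul_le_mul_of_nonneg_left (hexpA.trans hW) hC
      have h2 := mul_le_mul_of_nonneg_left (hexpB.trans hW) hC
      have h3 : 2 * C * Real.exp (δ₉ * (2 * Mc + 2)) * Real.exp (-(min (δ₉ / 8) δI) * recordRNat F Mc k K) *
          Real.exp (-(min (δ₉ / 8) δI * (Site.tdist (coarsenTo (k + 1) β.src) (recordE F k K μ z).2 : ℝ))) ≤
          (2 * C * Real.exp (δ₉ * (2 * Mc + 2)) + A) * Real.exp (-(min (δ₉ / 8) δI) * recordRNat F Mc k K) *
          Real.exp (-(min (δ₉ / 8) δI * (Site.tdist (coarsenTo (k + 1) β.src) (recordE F k K μ z).2 : ℝ))) :=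
        mul_le_mul_of_nonneg_right (mul_le_mul_of_nonneg_right hCA (Real.exp_pos _).le) (Real.exp_pos _).le
      linarith
    have key := clauses_sub_lift F (recordHrLocξ F (thetaFill F a₀ ε₂₉) k (K + 1) Finset.univ a (recordE F k (K + 1) μ z))
      (recordHrLocξ F (thetaFill F a₀ ε₂₉) k K Finset.univ a (recordE F k K μ z)) β.src β.dir hsh hun hus
      hA.1 hA.2.1 hA.2.2.1 hA.2.2.2 hB.1 hB.2.1 hB.2.2.1 hB.2.2.2
    obtain ⟨k1, k2, k3, k4⟩ := key
    refine ⟨k1.trans ?_, fun ν => (k2 ν).trans ?_, k3.trans ?_, k4.trans ?_⟩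
    · have := mul_le_mul_of_nonneg_left hsum hη0.le; linarith
    · have := mul_le_mul_of_nonneg_left hsum hη2.le; linarith
    · have := mul_le_mul_of_nonneg_left hsum hη3.le; linarith
    · have := mul_le_mul_of_nonneg_left hsum hη3.le; linarith

/-! ## §2  ★★★ The gauge row from per-bond clauses, and its images instance -/

/-- ★★ **ROW (R4ᴰ)′ FROM PER-BOND CLAUSES, TOKEN-FREE IN FORM**: for cut response vectors `g, g′` with `𝐔`-blocks `Matrix.of ∘ G`, `Matrix.of ∘ G′` on the domain bonds and `𝐉`-blocks
the (1.8) linearised currents, ANY per-bond bound of the four clause expressions of `E := G′ ∘ lift − G` of the form `Ĉ·η^j·e^{−r·tdist(coarse β₋, y₂)}` (`hcl`) gives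
`gauge (recordDom44J X α₂) (cutTo X (g′ ∘ recordJXJ − g)) ≤ Ĉ·(2(3 + 2‖π_ℝ‖)e^{4rMc}∕α₂)·e^{−r·dist(y, X)}` — the body of ✓`rowR4D_capped_sandwich` after its clause step.
[cite: Balaban1987RG1, (1.21) p.264, (4.4)–(4.5) pp.281–282, (4.35) p.290, (1.8) p.261; Balaban1985Variational, (190) p.308, Prop. 9 p.309] -/
theorem rowR4D_of_clauses (hMc : McGuard F Mc) (hK : recordK₀ F Mc k ≤ K) (y : RespLabel F k K) {X : (recordDomSys F Mc k K).Dom} (hX : X ∉ recordWrapCtr F Mc k K)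
    {Ch r : ℝ} (hCh : 0 < Ch) (hr : 0 ≤ r)
    (G : PBond (F.P K) 0 → Fin 2 → Fin 2 → ℂ) (G' : PBond (F.P (K + 1)) 0 → Fin 2 → Fin 2 → ℂ)
    (g : Fin (recordChartDimJ F K) → ℂ) (g' : Fin (recordChartDimJ F (K + 1)) → ℂ)
    (hU : ∀ b ∈ domBonds F Mc k K X, chartMatU F K (B12FormatPlus.cutTo (recordCXJ F Mc k K X) g) b = Matrix.of (fun i i' => G b i i'))
    (hU' : ∀ b' ∈ domBonds F Mc k (K + 1) (recordDomEmbCtr F Mc k K X),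
      chartMatU F (K + 1) (B12FormatPlus.cutTo (recordCXJ F Mc k (K + 1) (recordDomEmbCtr F Mc k K X)) g') b' = Matrix.of (fun i i' => G' b' i i'))
    (hJ : ∀ b ∈ domBonds F Mc k K X, letI H : PBond (F.P K) 0 → MatA 2 := fun b' => Matrix.of fun i i' => G b' i i';
      chartMatJc F K (B12FormatPlus.cutTo (recordCXJ F Mc k K X) g) b =
        ((((F.P K).eta (k + 1) : ℂ)⁻¹) ^ 3) • ((-I) • sl2Proj (∑ ν : Fin (F.P K).d,
          ((H ⟨b.src, b.dir⟩ + H ⟨b.src.shift b.dir, ν⟩ - H ⟨b.src.shift ν, b.dir⟩ - H ⟨b.src, ν⟩) -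
            (H ⟨b.src.unshift ν, b.dir⟩ + H ⟨(b.src.unshift ν).shift b.dir, ν⟩ - H ⟨(b.src.unshift ν).shift ν, b.dir⟩ - H ⟨b.src.unshift ν, ν⟩)))))
    (hJ' : ∀ b' ∈ domBonds F Mc k (K + 1) (recordDomEmbCtr F Mc k K X), letI H : PBond (F.P (K + 1)) 0 → MatA 2 := fun b'' => Matrix.of fun i i' => G' b'' i i';
      chartMatJc F (K + 1) (B12FormatPlus.cutTo (recordCXJ F Mc k (K + 1) (recordDomEmbCtr F Mc k K X)) g') b' =
        ((((F.P (K + 1)).eta (k + 1) : ℂ)⁻¹) ^ 3) • ((-I) • sl2Proj (∑ ν : Fin (F.P (K + 1)).d,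
          ((H ⟨b'.src, b'.dir⟩ + H ⟨b'.src.shift b'.dir, ν⟩ - H ⟨b'.src.shift ν, b'.dir⟩ - H ⟨b'.src, ν⟩) -
            (H ⟨b'.src.unshift ν, b'.dir⟩ + H ⟨(b'.src.unshift ν).shift b'.dir, ν⟩ - H ⟨(b'.src.unshift ν).shift ν, b'.dir⟩ - H ⟨b'.src.unshift ν, ν⟩)))))
    (hcl : ∀ β ∈ domBonds F Mc k K X,
      letI E : PBond (F.P K) 0 → Fin 2 → Fin 2 → ℂ := fun b' => G' (liftBondCtr F K 0 b') - G b'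
      letI e : ℝ := Real.exp (-(r * (Site.tdist (coarsenTo (k + 1) β.src) y.2 : ℝ)))
      ‖E ⟨β.src, β.dir⟩‖ ≤ Ch * (F.P K).eta (k + 1) * e ∧
      (∀ ν : Fin (F.P K).d, ‖E ⟨β.src.shift ν, β.dir⟩ - E ⟨β.src, β.dir⟩‖ ≤ Ch * (F.P K).eta (k + 1) ^ 2 * e) ∧
      ‖∑ ν : Fin (F.P K).d, (E ⟨β.src.shift ν, β.dir⟩ - (2 : ℂ) • E ⟨β.src, β.dir⟩ + E ⟨β.src.unshift ν, β.dir⟩)‖ ≤ Ch * (F.P K).eta (k + 1) ^ 3 * e ∧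
      ‖∑ ν : Fin (F.P K).d, ((E ⟨β.src, β.dir⟩ + E ⟨β.src.shift β.dir, ν⟩ - E ⟨β.src.shift ν, β.dir⟩ - E ⟨β.src, ν⟩) -
        (E ⟨β.src.unshift ν, β.dir⟩ + E ⟨(β.src.unshift ν).shift β.dir, ν⟩ - E ⟨(β.src.unshift ν).shift ν, β.dir⟩ - E ⟨β.src.unshift ν, ν⟩))‖ ≤ Ch * (F.P K).eta (k + 1) ^ 3 * e)
    {α₂ : ℝ} (hα : 0 < α₂) :
    gauge (recordDom44J F Mc k K X α₂) (B12FormatPlus.cutTo (recordCXJ F Mc k K X) fun i => g' (recordJXJ F K i) - g i) ≤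
      Ch * (2 * (2 * 1 + 2 * ‖LinearMap.toContinuousLinearMap (sl2Proj.restrictScalars ℝ)‖ + 1) * Real.exp (4 * r * Mc) / α₂) *
        Real.exp (-r * (recordSiteGeom F Mc k K).distD y X) := by
  classical
  have hη0 : 0 < (F.P K).eta (k + 1) := by unfold Params.eta; exact pow_pos (inv_pos.2 (F.P K).cast_L_pos) _
  have heta : (F.P (K + 1)).eta (k + 1) = (F.P K).eta (k + 1) := rfl
  -- the difference vector, its `𝐔`-block and `𝐉`-block
  have hcut : B12FormatPlus.cutTo (recordCXJ F Mc k K X) (fun i => g' (recordJXJ F K i) - g i) =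
      (fun i => B12FormatPlus.cutTo (recordCXJ F Mc k (K + 1) (recordDomEmbCtr F Mc k K X)) g' (recordJXJ F K i)) - B12FormatPlus.cutTo (recordCXJ F Mc k K X) g := by
    rw [show (fun i => g' (recordJXJ F K i) - g i) = (fun i => g' (recordJXJ F K i)) - g from rfl, cutTo_sub, cutTo_comp_recordJXJ hMc hK hX]
  have hUE : ∀ b ∈ domBonds F Mc k K X, chartMatU F K (B12FormatPlus.cutTo (recordCXJ F Mc k K X) fun i => g' (recordJXJ F K i) - g i) b =
      Matrix.of ((fun b' : PBond (F.P K) 0 => G' (liftBondCtr F K 0 b') - G b') b) := by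
    intro b hb
    have hb' : liftBondCtr F K 0 b ∈ domBonds F Mc k (K + 1) (recordDomEmbCtr F Mc k K X) := (liftBondCtr_mem_domBonds_iff hMc hK X hX b).2 hb
    rw [hcut, chartMatU_sub, chartMatU_comp_recordJXJ, hU' _ hb', hU _ hb]
    ext i i'; simp
  -- the `𝐉`-block: `ξ⁻³·(−i)·π(d*d E)`
  have hJE : ∀ b ∈ domBonds F Mc k K X, ‖chartMatJc F K (B12FormatPlus.cutTo (recordCXJ F Mc k K X) fun i => g' (recordJXJ F K i) - g i) b‖ ≤
      Ch * (2 * ‖LinearMap.toContinuousLinearMap (sl2Proj.restrictScalars ℝ)‖) * Real.exp (-(r * (Site.tdist (coarsenTo (k + 1) b.src) y.2 : ℝ))) := by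
    intro b hb
    have hb' : liftBondCtr F K 0 b ∈ domBonds F Mc k (K + 1) (recordDomEmbCtr F Mc k K X) := (liftBondCtr_mem_domBonds_iff hMc hK X hX b).2 hb
    obtain ⟨hsh, hun, hus⟩ := stencil_commute_of_mem_domBonds hMc hK hX hb
    rw [hcut, chartMatJc_sub, chartMatJc_comp_recordJXJ, hJ' _ hb', hJ _ hb, heta, ← smul_sub, ← smul_sub, ← map_sub]
    refine (norm_current_lin_le sl2Proj hη0 _).trans ?_
    have h4 := (hcl b hb).2.2.2
    have h2 := (norm_of_le_two_mul_norm _).trans (mul_le_mul_of_nonneg_left h4 zero_le_two)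
    have hπ0 : 0 ≤ (((F.P K).eta (k + 1))⁻¹) ^ 3 * ‖LinearMap.toContinuousLinearMap (sl2Proj.restrictScalars ℝ)‖ := by positivity
    refine le_trans (le_of_eq ?_) ((mul_le_mul_of_nonneg_left h2 hπ0).trans (le_of_eq ?_))
    · -- the matrix identity: (K+1)-stencil at the lifted bond − K-stencil = `Matrix.of` of the stencil of `E`
      congr 2
      change (∑ ν : Fin (F.P K).d, _) - _ = _
      rw [← Finset.sum_sub_distrib]
      ext i i'
      simp only [Matrix.sum_apply, Matrix.sub_apply, Matrix.add_apply, Matrix.of_apply, Finset.sum_apply, Pi.sub_apply, Pi.add_apply, liftBondCtr,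
        hsh, hun, hus]
      exact Finset.sum_congr rfl fun ν _ => by ring
    · have hη3 : ((F.P K).eta (k + 1))⁻¹ ^ 3 * (F.P K).eta (k + 1) ^ 3 = 1 := by field_simp
      linear_combination (2 * ‖LinearMap.toContinuousLinearMap (sl2Proj.restrictScalars ℝ)‖ * Ch *
        Real.exp (-(r * (Site.tdist (coarsenTo (k + 1) b.src) y.2 : ℝ)))) * hη3
  -- the homogeneous generic row
  exact gauge_recordDom44J_cutTo_le_of_entryDecayOn_homog (F := F) hMc hK X y
    (fun i => g' (recordJXJ F K i) - g i) (fun b' : PBond (F.P K) 0 => G' (liftBondCtr F K 0 b') - G b')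
    hα hCh (P := 2 * ‖LinearMap.toContinuousLinearMap (sl2Proj.restrictScalars ℝ)‖) (δ₉ := r) (by positivity) hr hUE
    (fun b hb => ⟨(hcl b hb).1, fun ν => (hcl b hb).2.1 ν, (hcl b hb).2.2.1⟩) hJE

/-- ★★★ **ROW (R4ᴰ)′ FOR THE WHOLE-TORUS LOCALIZED DATA WITHOUT (Tok-cmpU-cap)** (one member `K`, one off-wrap domain `X`, one N-slot label): under the ‴-clauses on
`recordHrLocξ … Finset.univ` at both members (displayed; PROVED upstream) and the images clauses of file 4b (`hI`; PROVED: ✓`images_near_clauses`), the gauge of the cut two-volume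
difference of the whole-torus localized linear responses is `≤ Ĉ·(2(3 + 2‖π_ℝ‖)e^{4rMc}∕α₂)·e^{−r·dist(y, X)}`, `r = min(δ₉∕8, δ_I)`, `Ĉ = (2C·e^{δ₉(2Mc+2)} + A)·e^{−r·ρ}`.
[cite: Balaban1987RG1, (1.21) p.264, (4.4)–(4.5) pp.281–282, p.290 L17–20, (4.35) p.290, (1.8) p.261; Balaban1985Variational, (190) p.308, Prop. 9 p.309; Balaban1984PropagatorsI, p.36 ll.20–23] -/
theorem rowR4D_LocUniv_images (hMc : McGuard F Mc) (hK : recordK₀ F Mc k ≤ K) (a : (thetaFill F a₀ ε₂₉).ιβ) (μ : Fin 4) (z : Fin 4 → ℤ)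
    (hz : ∀ l, 2 * |z l| < (recordRNat F Mc k K : ℤ)) {X : (recordDomSys F Mc k K).Dom} (hX : X ∉ recordWrapCtr F Mc k K)
    {C δ₉ : ℝ} (hC : 0 < C) (hδ : 0 < δ₉)
    (h3 : letI Hr := recordHrLocξ F (thetaFill F a₀ ε₂₉) k K Finset.univ a (recordE F k K μ z);
      ∀ b : PBond (F.P K) 0,
        ‖Hr b‖ ≤ C * (F.P K).eta (k + 1) * Real.exp (-(δ₉ * (Site.tdist (coarsenTo (k + 1) b.src) (recordE F k K μ z).2 : ℝ))) ∧
        (∀ ν : Fin (F.P K).d, ‖Hr ⟨b.src.shift ν, b.dir⟩ - Hr b‖ ≤ C * (F.P K).eta (k + 1) ^ 2 * Real.exp (-(δ₉ * (Site.tdist (coarsenTo (k + 1) b.src) (recordE F k K μ z).2 : ℝ)))) ∧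
        ‖∑ ν : Fin (F.P K).d, (Hr ⟨b.src.shift ν, b.dir⟩ - (2 : ℂ) • Hr b + Hr ⟨b.src.unshift ν, b.dir⟩)‖ ≤
          C * (F.P K).eta (k + 1) ^ 3 * Real.exp (-(δ₉ * (Site.tdist (coarsenTo (k + 1) b.src) (recordE F k K μ z).2 : ℝ))) ∧
        ‖∑ ν : Fin (F.P K).d, ((Hr ⟨b.src, b.dir⟩ + Hr ⟨(b.src).shift b.dir, ν⟩ - Hr ⟨(b.src).shift ν, b.dir⟩ - Hr ⟨b.src, ν⟩) -
          (Hr ⟨b.src.unshift ν, b.dir⟩ + Hr ⟨(b.src.unshift ν).shift b.dir, ν⟩ - Hr ⟨(b.src.unshift ν).shift ν, b.dir⟩ - Hr ⟨b.src.unshift ν, ν⟩))‖ ≤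
          C * (F.P K).eta (k + 1) ^ 3 * Real.exp (-(δ₉ * (Site.tdist (coarsenTo (k + 1) b.src) (recordE F k K μ z).2 : ℝ))))
    (h3' : letI Hr := recordHrLocξ F (thetaFill F a₀ ε₂₉) k (K + 1) Finset.univ a (recordE F k (K + 1) μ z);
      ∀ b : PBond (F.P (K + 1)) 0,
        ‖Hr b‖ ≤ C * (F.P (K + 1)).eta (k + 1) * Real.exp (-(δ₉ * (Site.tdist (coarsenTo (k + 1) b.src) (recordE F k (K + 1) μ z).2 : ℝ))) ∧
        (∀ ν : Fin (F.P (K + 1)).d, ‖Hr ⟨b.src.shift ν, b.dir⟩ - Hr b‖ ≤ C * (F.P (K + 1)).eta (k + 1) ^ 2 * Real.exp (-(δ₉ * (Site.tdist (coarsenTo (k + 1) b.src) (recordE F k (K + 1) μ z).2 : ℝ)))) ∧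
        ‖∑ ν : Fin (F.P (K + 1)).d, (Hr ⟨b.src.shift ν, b.dir⟩ - (2 : ℂ) • Hr b + Hr ⟨b.src.unshift ν, b.dir⟩)‖ ≤
          C * (F.P (K + 1)).eta (k + 1) ^ 3 * Real.exp (-(δ₉ * (Site.tdist (coarsenTo (k + 1) b.src) (recordE F k (K + 1) μ z).2 : ℝ))) ∧
        ‖∑ ν : Fin (F.P (K + 1)).d, ((Hr ⟨b.src, b.dir⟩ + Hr ⟨(b.src).shift b.dir, ν⟩ - Hr ⟨(b.src).shift ν, b.dir⟩ - Hr ⟨b.src, ν⟩) -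
          (Hr ⟨b.src.unshift ν, b.dir⟩ + Hr ⟨(b.src.unshift ν).shift b.dir, ν⟩ - Hr ⟨(b.src.unshift ν).shift ν, b.dir⟩ - Hr ⟨b.src.unshift ν, ν⟩))‖ ≤
          C * (F.P (K + 1)).eta (k + 1) ^ 3 * Real.exp (-(δ₉ * (Site.tdist (coarsenTo (k + 1) b.src) (recordE F k (K + 1) μ z).2 : ℝ))))
    {δI A : ℝ} (hδI : 0 ≤ δI) (hA : 0 ≤ A)
    (hI : ∀ R : ℕ, (∀ i, 2 * (|(-z) i| + R) < ((F.P K).sitesPerDir (k + 1) : ℤ)) →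
      ∀ {X : (recordDomSys F Mc k K).Dom}, X ∉ recordWrapCtr F Mc k K → ∀ {β : PBond (F.P K) 0}, β ∈ domBonds F Mc k K X →
      coarsenTo (k + 1) β.src ∈ recordWindow F k K R (-z) →
      letI E : PBond (F.P K) 0 → Fin 2 → Fin 2 → ℂ := fun b' =>
        recordHrLocξ F (thetaFill F a₀ ε₂₉) k (K + 1) Finset.univ a (recordE F k (K + 1) μ z) (liftBondCtr F K 0 b') - recordHrLocξ F (thetaFill F a₀ ε₂₉) k K Finset.univ a (recordE F k K μ z) b'
      letI B : ℝ := A * Real.exp (-(δI * ((F.P K).sitesPerDir (k + 1) : ℝ)))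
      ‖E ⟨β.src, β.dir⟩‖ ≤ B * (F.P K).eta (k + 1) ∧
      (∀ ν : Fin (F.P K).d, ‖E ⟨β.src.shift ν, β.dir⟩ - E ⟨β.src, β.dir⟩‖ ≤ B * (F.P K).eta (k + 1) ^ 2) ∧
      ‖∑ ν : Fin (F.P K).d, (E ⟨β.src.shift ν, β.dir⟩ - (2 : ℂ) • E ⟨β.src, β.dir⟩ + E ⟨β.src.unshift ν, β.dir⟩)‖ ≤ B * (F.P K).eta (k + 1) ^ 3 ∧
      ‖∑ ν : Fin (F.P K).d, ((E ⟨β.src, β.dir⟩ + E ⟨β.src.shift β.dir, ν⟩ - E ⟨β.src.shift ν, β.dir⟩ - E ⟨β.src, ν⟩) -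
        (E ⟨β.src.unshift ν, β.dir⟩ + E ⟨(β.src.unshift ν).shift β.dir, ν⟩ - E ⟨(β.src.unshift ν).shift ν, β.dir⟩ - E ⟨β.src.unshift ν, ν⟩))‖ ≤
        B * (F.P K).eta (k + 1) ^ 3)
    {α₂ : ℝ} (hα : 0 < α₂) :
    gauge (recordDom44J F Mc k K X α₂) (B12FormatPlus.cutTo (recordCXJ F Mc k K X) fun i =>
        recordGkLocWξ F (thetaFill F a₀ ε₂₉) k (K + 1) Finset.univ a (recordE F k (K + 1) μ z) (recordJXJ F K i) -
          recordGkLocWξ F (thetaFill F a₀ ε₂₉) k K Finset.univ a (recordE F k K μ z) i) ≤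
      ((2 * C * Real.exp (δ₉ * (2 * Mc + 2)) + A) * Real.exp (-(min (δ₉ / 8) δI) * recordRNat F Mc k K)) *
        (2 * (2 * 1 + 2 * ‖LinearMap.toContinuousLinearMap (sl2Proj.restrictScalars ℝ)‖ + 1) * Real.exp (4 * (min (δ₉ / 8) δI) * Mc) / α₂) *
        Real.exp (-(min (δ₉ / 8) δI) * (recordSiteGeom F Mc k K).distD (recordE F k K μ z) X) := by
  classical
  have hCh : 0 < (2 * C * Real.exp (δ₉ * (2 * Mc + 2)) + A) * Real.exp (-(min (δ₉ / 8) δI) * recordRNat F Mc k K) := by positivity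
  exact rowR4D_of_clauses hMc hK (recordE F k K μ z) hX hCh (le_min (by positivity) hδI)
    (recordHrLocξ F (thetaFill F a₀ ε₂₉) k K Finset.univ a (recordE F k K μ z))
    (recordHrLocξ F (thetaFill F a₀ ε₂₉) k (K + 1) Finset.univ a (recordE F k (K + 1) μ z)) _ _
    (fun b hb => by rw [chartMatU_cutTo_recordGkLocWξ, if_pos hb])
    (fun b' hb' => by rw [chartMatU_cutTo_recordGkLocWξ, if_pos hb'])
    (fun b hb => by rw [chartMatJc_cutTo_recordGkLocWξ, if_pos hb, recordJLocξ_eq])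
    (fun b' hb' => by rw [chartMatJc_cutTo_recordGkLocWξ, if_pos hb', recordJLocξ_eq])
    (fun β hβ => sandwich_clauses_images a₀ ε₂₉ hMc hK a μ z hz hX hC.le hδ h3 h3' hδI hA hI hβ) hα

end Images

end Summit.QuantumFields.YangMills.Theorems.PortU8

end
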